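import Mathlib
import Summits.KontsevichZagierPeriods.KontsevichZagierPeriods.Theorems.SoloInformedNonintLocal
import HarnessLib
import HarnessLib.Audit

/-!
# SoloInformed — the two sides of a graph in a box; frontier points force an adjacent band (PRES-RAT(2), Phase IV-5)

Solo programme `solo-KontsevichZagierPeriods-informed`, session s110.  Topology of an open box
`(u, v) × (c, d)` cut by the graph of a continuous function `a : (u, v) → (c, d)`:

* the parts above / below the graph are (pre)connected (images of a rectangle under the
  straightening shear);
* a preconnected set missing the frontier of an open set `Ω` lies inside `Ω` or misses it
  (clopen argument);
* hence if `frontier Ω ∩ box ⊆ graph(a)` and some point of the box lies on `frontier Ω`, then the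
  whole upper part or the whole lower part of the box is contained in `Ω`, and `Ω` contains a band
  adjacent to the graph;
* combined with NONINT-LOCAL: if moreover the graph is a real branch of `Z(D)` with `N ≠ 0` at the
  frontier point, `N/D` is not integrable on `Ω` (`soloInformed_nonint_frontier`).

References: folklore (point-set topology).
-/

noncomputable section

open scoped BigOperators Topology
open MeasureTheory Set Filter Metric

namespace Summit.KontsevichZagierPeriods.KontsevichZagierPeriods.Theorems

/-! ### Boxes and the two sides of a graph -/

/-- The open box `(u, v) × (c, d) ⊆ ℝ²`. [this work] -/
def soloInformedBox2 (u v c d : ℝ) : Set (Fin 2 → ℝ) :=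
  {z | (u < z 0 ∧ z 0 < v) ∧ (c < z 1 ∧ z 1 < d)}

/-- The part of the box `(u, v) × (c, d)` strictly above the graph of `a`. [this work] -/
def soloInformedBox2Above (a : ℝ → ℝ) (u v c d : ℝ) : Set (Fin 2 → ℝ) :=
  {z | z ∈ soloInformedBox2 u v c d ∧ a (z 0) < z 1}

/-- The part of the box `(u, v) × (c, d)` strictly below the graph of `a`. [this work] -/
def soloInformedBox2Below (a : ℝ → ℝ) (u v c d : ℝ) : Set (Fin 2 → ℝ) :=
  {z | z ∈ soloInformedBox2 u v c d ∧ z 1 < a (z 0)}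

/-- The box as an intersection of two coordinate preimages. -/
theorem soloInformed_box2_eq (u v c d : ℝ) :
    soloInformedBox2 u v c d =
      ((fun z : Fin 2 → ℝ => z 0) ⁻¹' Ioo u v) ∩ ((fun z : Fin 2 → ℝ => z 1) ⁻¹' Ioo c d) := by
  ext z
  simp only [soloInformedBox2, mem_setOf_eq, mem_inter_iff, mem_preimage, mem_Ioo]

/-- The box is open. -/
theorem soloInformed_isOpen_box2 (u v c d : ℝ) : IsOpen (soloInformedBox2 u v c d) := by
  rw [soloInformed_box2_eq]
  exact ((continuous_apply 0).isOpen_preimage _ isOpen_Ioo).inter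
    ((continuous_apply 1).isOpen_preimage _ isOpen_Ioo)

/-- The rectangle `(u, v) × (0, 1)` is convex. -/
theorem soloInformed_convex_rect (u v : ℝ) : Convex ℝ (soloInformedRect u v) := by
  have hl : ∀ i : Fin 2, IsLinearMap ℝ (fun w : Fin 2 → ℝ => w i) :=
    fun i => ⟨fun x y => rfl, fun c x => rfl⟩
  have h := (((convex_halfSpace_gt (hl 0) u).inter (convex_halfSpace_lt (hl 0) v)).inter
    (convex_halfSpace_gt (hl 1) 0)).inter (convex_halfSpace_lt (hl 1) 1)
  have hrect : soloInformedRect u v =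
      {w | u < w 0} ∩ {w | w 0 < v} ∩ {w | (0 : ℝ) < w 1} ∩ {w | w 1 < 1} := by
    ext w
    constructor
    · rintro ⟨⟨h1, h2⟩, h3, h4⟩
      exact ⟨⟨⟨h1, h2⟩, h3⟩, h4⟩
    · rintro ⟨⟨⟨h1, h2⟩, h3⟩, h4⟩
      exact ⟨⟨h1, h2⟩, h3, h4⟩
  rw [hrect]
  exact h

/-- The straightening shear is continuous on the rectangle when `a, b` are continuous on
`(u, v)`. -/
theorem soloInformed_continuousOn_bandMap {a b : ℝ → ℝ} {u v : ℝ}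
    (ha : ContinuousOn a (Ioo u v)) (hb : ContinuousOn b (Ioo u v)) :
    ContinuousOn (soloInformedBandMap a b) (soloInformedRect u v) := by
  have h0 : ContinuousOn (fun x : Fin 2 → ℝ => x 0) (soloInformedRect u v) :=
    (continuous_apply 0).continuousOn
  have h1 : ContinuousOn (fun x : Fin 2 → ℝ => x 1) (soloInformedRect u v) :=
    (continuous_apply 1).continuousOn
  have hmaps : MapsTo (fun x : Fin 2 → ℝ => x 0) (soloInformedRect u v) (Ioo u v) :=
    fun x hx => hx.1
  have ha' : ContinuousOn (fun x : Fin 2 → ℝ => a (x 0)) (soloInformedRect u v) := ha.comp h0 hmaps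
  have hb' : ContinuousOn (fun x : Fin 2 → ℝ => b (x 0)) (soloInformedRect u v) := hb.comp h0 hmaps
  have hsnd : ContinuousOn (fun x : Fin 2 → ℝ => a (x 0) + x 1 * (b (x 0) - a (x 0)))
      (soloInformedRect u v) := ha'.add (h1.mul (hb'.sub ha'))
  refine continuousOn_pi.2 fun i => ?_
  fin_cases i
  · exact h0.congr (fun x _ => by simp)
  · exact hsnd.congr (fun x _ => by simp)

/-- The upper part of the box is the image of the rectangle under the shear between `a` and the
top edge. -/
theorem soloInformed_box2Above_eq_image {a : ℝ → ℝ} {u v c d : ℝ}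
    (hin : ∀ s : ℝ, u < s → s < v → c < a s ∧ a s < d) :
    soloInformedBox2Above a u v c d =
      soloInformedBandMap a (fun _ => d) '' soloInformedRect u v := by
  rw [soloInformed_bandMap_image_rect (fun s h1 h2 => (hin s h1 h2).2)]
  ext z
  simp only [soloInformedBox2Above, soloInformedBox2, mem_setOf_eq]
  constructor
  · rintro ⟨⟨hx, -, hd⟩, hlt⟩
    exact ⟨hx, hlt, hd⟩
  · rintro ⟨hx, hlt, hd⟩
    exact ⟨⟨hx, by linarith [(hin _ hx.1 hx.2).1], hd⟩, hlt⟩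

/-- The lower part of the box is the image of the rectangle under the shear between the bottom
edge and `a`. -/
theorem soloInformed_box2Below_eq_image {a : ℝ → ℝ} {u v c d : ℝ}
    (hin : ∀ s : ℝ, u < s → s < v → c < a s ∧ a s < d) :
    soloInformedBox2Below a u v c d =
      soloInformedBandMap (fun _ => c) a '' soloInformedRect u v := by
  rw [soloInformed_bandMap_image_rect (fun s h1 h2 => (hin s h1 h2).1)]
  ext z
  simp only [soloInformedBox2Below, soloInformedBox2, mem_setOf_eq]
  constructor
  · rintro ⟨⟨hx, hc, -⟩, hlt⟩
    exact ⟨hx, hc, hlt⟩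
  · rintro ⟨hx, hc, hlt⟩
    exact ⟨⟨hx, hc, by linarith [(hin _ hx.1 hx.2).2]⟩, hlt⟩

/-- The upper part of a box cut by a continuous graph is preconnected. -/
theorem soloInformed_isPreconnected_box2Above {a : ℝ → ℝ} {u v c d : ℝ}
    (ha : ContinuousOn a (Ioo u v)) (hin : ∀ s : ℝ, u < s → s < v → c < a s ∧ a s < d) :
    IsPreconnected (soloInformedBox2Above a u v c d) := by
  rw [soloInformed_box2Above_eq_image hin]
  exact (soloInformed_convex_rect u v).isPreconnected.image _
    (soloInformed_continuousOn_bandMap ha continuousOn_const)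

/-- The lower part of a box cut by a continuous graph is preconnected. -/
theorem soloInformed_isPreconnected_box2Below {a : ℝ → ℝ} {u v c d : ℝ}
    (ha : ContinuousOn a (Ioo u v)) (hin : ∀ s : ℝ, u < s → s < v → c < a s ∧ a s < d) :
    IsPreconnected (soloInformedBox2Below a u v c d) := by
  rw [soloInformed_box2Below_eq_image hin]
  exact (soloInformed_convex_rect u v).isPreconnected.image _
    (soloInformed_continuousOn_bandMap continuousOn_const ha)

/-! ### The clopen argument -/

/-- A preconnected set missing the frontier of an open set `Ω` lies inside `Ω` or is disjoint
from it. -/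
theorem soloInformed_subset_or_disjoint_of_frontier {X : Type*} [TopologicalSpace X]
    {W Ω : Set X} (hW : IsPreconnected W) (hΩ : IsOpen Ω) (h : Disjoint W (frontier Ω)) :
    W ⊆ Ω ∨ Disjoint W Ω := by
  have hcover : W ⊆ Ω ∪ (closure Ω)ᶜ := by
    intro w hw
    by_cases hc : w ∈ closure Ω
    · left
      by_contra hwΩ
      have : w ∈ frontier Ω := by
        rw [hΩ.frontier_eq]
        exact ⟨hc, hwΩ⟩
      exact (Set.disjoint_left.1 h) hw this
    · right
      exact hc
  have hdisj : Disjoint Ω (closure Ω)ᶜ :=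
    Set.disjoint_left.2 fun x hx hx' => hx' (subset_closure hx)
  by_cases hne : (W ∩ Ω).Nonempty
  · left
    exact hW.subset_left_of_subset_union hΩ isClosed_closure.isOpen_compl hdisj hcover hne
  · right
    rw [Set.not_nonempty_iff_eq_empty] at hne
    exact Set.disjoint_iff_inter_eq_empty.2 hne

/-- If the frontier of `Ω` inside the box lies on the graph, the upper part is inside `Ω` or
misses `Ω`. -/
theorem soloInformed_box2Above_subset_or_disjoint {a : ℝ → ℝ} {u v c d : ℝ} {Ω : Set (Fin 2 → ℝ)}
    (hΩ : IsOpen Ω) (ha : ContinuousOn a (Ioo u v))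
    (hin : ∀ s : ℝ, u < s → s < v → c < a s ∧ a s < d)
    (hfr : ∀ z ∈ soloInformedBox2 u v c d, z ∈ frontier Ω → z 1 = a (z 0)) :
    soloInformedBox2Above a u v c d ⊆ Ω ∨ Disjoint (soloInformedBox2Above a u v c d) Ω := by
  refine soloInformed_subset_or_disjoint_of_frontier (soloInformed_isPreconnected_box2Above ha hin)
    hΩ (Set.disjoint_left.2 fun z hz hzf => ?_)
  have := hfr z hz.1 hzf
  linarith [hz.2]

/-- If the frontier of `Ω` inside the box lies on the graph, the lower part is inside `Ω` or
misses `Ω`. -/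
theorem soloInformed_box2Below_subset_or_disjoint {a : ℝ → ℝ} {u v c d : ℝ} {Ω : Set (Fin 2 → ℝ)}
    (hΩ : IsOpen Ω) (ha : ContinuousOn a (Ioo u v))
    (hin : ∀ s : ℝ, u < s → s < v → c < a s ∧ a s < d)
    (hfr : ∀ z ∈ soloInformedBox2 u v c d, z ∈ frontier Ω → z 1 = a (z 0)) :
    soloInformedBox2Below a u v c d ⊆ Ω ∨ Disjoint (soloInformedBox2Below a u v c d) Ω := by
  refine soloInformed_subset_or_disjoint_of_frontier (soloInformed_isPreconnected_box2Below ha hin)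
    hΩ (Set.disjoint_left.2 fun z hz hzf => ?_)
  have := hfr z hz.1 hzf
  linarith [hz.2]

/-- **A frontier point on the graph forces a side.**  If `frontier Ω ∩ box ⊆ graph(a)` and the
box contains a frontier point of the open set `Ω`, then the whole upper part or the whole lower
part of the box lies in `Ω`. -/
theorem soloInformed_side_subset_of_mem_frontier {a : ℝ → ℝ} {u v c d : ℝ}
    {Ω : Set (Fin 2 → ℝ)} (hΩ : IsOpen Ω) (ha : ContinuousOn a (Ioo u v))
    (hin : ∀ s : ℝ, u < s → s < v → c < a s ∧ a s < d)
    (hfr : ∀ z ∈ soloInformedBox2 u v c d, z ∈ frontier Ω → z 1 = a (z 0))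
    {p : Fin 2 → ℝ} (hp : p ∈ soloInformedBox2 u v c d) (hpf : p ∈ frontier Ω) :
    soloInformedBox2Above a u v c d ⊆ Ω ∨ soloInformedBox2Below a u v c d ⊆ Ω := by
  have hpc : p ∈ closure Ω := frontier_subset_closure hpf
  obtain ⟨q, hqB, hqΩ⟩ := mem_closure_iff_nhds.1 hpc _
    ((soloInformed_isOpen_box2 u v c d).mem_nhds hp)
  have hA := soloInformed_box2Above_subset_or_disjoint hΩ ha hin hfr
  have hB := soloInformed_box2Below_subset_or_disjoint hΩ ha hin hfr
  rcases lt_trichotomy (a (q 0)) (q 1) with hlt | heq | hgt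
  · left
    exact hA.resolve_right fun hd => (Set.disjoint_left.1 hd) ⟨hqB, hlt⟩ hqΩ
  · -- `q` lies on the graph: push it upwards inside the open set `Ω ∩ box`
    left
    obtain ⟨ε, hε, hball⟩ :=
      Metric.isOpen_iff.1 (hΩ.inter (soloInformed_isOpen_box2 u v c d)) q ⟨hqΩ, hqB⟩
    set q' : Fin 2 → ℝ := ![q 0, q 1 + ε / 2] with hq'
    have hq'ball : q' ∈ ball q ε := by
      rw [mem_ball, dist_pi_lt_iff hε]
      intro i
      fin_cases i
      · simp [hq', hε]
      · simp only [hq']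
        rw [Real.dist_eq]
        simp [abs_of_pos (half_pos hε), hε]
    obtain ⟨hq'Ω, hq'B⟩ := hball hq'ball
    refine hA.resolve_right fun hd => (Set.disjoint_left.1 hd) ⟨hq'B, ?_⟩ hq'Ω
    simp only [hq', Matrix.cons_val_zero, Matrix.cons_val_one]
    linarith
  · right
    exact hB.resolve_right fun hd => (Set.disjoint_left.1 hd) ⟨hqB, hgt⟩ hqΩ

/-! ### Extracting an adjacent band -/

/-- If the upper part of the box lies in `Ω`, then `Ω` contains a band of constant height
adjacent from above to the graph near any abscissa `s₀`. -/
theorem soloInformed_exists_adjBand_subset {a : ℝ → ℝ} {u v c d s₀ : ℝ} {Ω : Set (Fin 2 → ℝ)}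
    (hs₀ : u < s₀ ∧ s₀ < v) (hcont : ContinuousAt a s₀)
    (hin : ∀ s : ℝ, u < s → s < v → c < a s ∧ a s < d)
    (hsub : soloInformedBox2Above a u v c d ⊆ Ω) :
    ∃ u' v' η : ℝ, (u' < s₀ ∧ s₀ < v') ∧ 0 < η ∧ u ≤ u' ∧ v' ≤ v ∧
      soloInformedAdjBand a u' v' η ⊆ Ω := by
  have hd : a s₀ < d := (hin s₀ hs₀.1 hs₀.2).2
  set η : ℝ := (d - a s₀) / 2 with hη
  have hηpos : 0 < η := by
    rw [hη]
    linarith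
  obtain ⟨ρ, hρ, hρa⟩ := Metric.continuousAt_iff.1 hcont η hηpos
  refine ⟨max u (s₀ - ρ), min v (s₀ + ρ), η,
    ⟨max_lt hs₀.1 (by linarith), lt_min hs₀.2 (by linarith)⟩, hηpos, le_max_left _ _,
    min_le_left _ _, fun z hz => hsub ?_⟩
  obtain ⟨⟨hz0l, hz0r⟩, hz1l, hz1r⟩ := hz
  have hu' : u < z 0 := lt_of_le_of_lt (le_max_left _ _) hz0l
  have hv' : z 0 < v := lt_of_lt_of_le hz0r (min_le_left _ _)
  have hρ' : dist (z 0) s₀ < ρ := by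
    rw [Real.dist_eq, abs_lt]
    constructor
    · linarith [le_max_right u (s₀ - ρ)]
    · linarith [min_le_right v (s₀ + ρ)]
  have haz : a (z 0) < a s₀ + η := by
    have h := hρa hρ'
    rw [Real.dist_eq, abs_lt] at h
    linarith [h.2]
  refine ⟨⟨⟨hu', hv'⟩, ?_, ?_⟩, hz1l⟩
  · linarith [(hin _ hu' hv').1]
  · rw [hη] at haz
    linarith

/-- If the lower part of the box lies in `Ω`, then `Ω` contains a band of constant height
adjacent from below to the graph near any abscissa `s₀`. -/
theorem soloInformed_exists_adjBandBelow_subset {a : ℝ → ℝ} {u v c d s₀ : ℝ}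
    {Ω : Set (Fin 2 → ℝ)} (hs₀ : u < s₀ ∧ s₀ < v) (hcont : ContinuousAt a s₀)
    (hin : ∀ s : ℝ, u < s → s < v → c < a s ∧ a s < d)
    (hsub : soloInformedBox2Below a u v c d ⊆ Ω) :
    ∃ u' v' η : ℝ, (u' < s₀ ∧ s₀ < v') ∧ 0 < η ∧ u ≤ u' ∧ v' ≤ v ∧
      soloInformedAdjBandBelow a u' v' η ⊆ Ω := by
  have hc : c < a s₀ := (hin s₀ hs₀.1 hs₀.2).1
  set η : ℝ := (a s₀ - c) / 2 with hη
  have hηpos : 0 < η := by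
    rw [hη]
    linarith
  obtain ⟨ρ, hρ, hρa⟩ := Metric.continuousAt_iff.1 hcont η hηpos
  refine ⟨max u (s₀ - ρ), min v (s₀ + ρ), η,
    ⟨max_lt hs₀.1 (by linarith), lt_min hs₀.2 (by linarith)⟩, hηpos, le_max_left _ _,
    min_le_left _ _, fun z hz => hsub ?_⟩
  obtain ⟨⟨hz0l, hz0r⟩, hz1l, hz1r⟩ := hz
  have hu' : u < z 0 := lt_of_le_of_lt (le_max_left _ _) hz0l
  have hv' : z 0 < v := lt_of_lt_of_le hz0r (min_le_left _ _)
  have hρ' : dist (z 0) s₀ < ρ := by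
    rw [Real.dist_eq, abs_lt]
    constructor
    · linarith [le_max_right u (s₀ - ρ)]
    · linarith [min_le_right v (s₀ + ρ)]
  have haz : a s₀ - η < a (z 0) := by
    have h := hρa hρ'
    rw [Real.dist_eq, abs_lt] at h
    linarith [h.1]
  refine ⟨⟨⟨hu', hv'⟩, ?_, ?_⟩, hz1r⟩
  · rw [hη] at haz
    linarith
  · linarith [(hin _ hu' hv').2]

/-! ### NONINT at a frontier point of a denominator branch -/

variable {K : Type*} [Field K] [Algebra K ℝ]

/-- **NONINT at a frontier point.**  Inside a box, let the frontier of the open set `Ω` lie on the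
graph of a differentiable function `a`, a real branch of `Z(D)`; if a point `(s₀, a(s₀))` of the
graph belongs to `frontier Ω` and `N(s₀, a(s₀)) ≠ 0`, then `N/D` (with `D ≠ 0` on `Ω`) is not
integrable on `Ω`. -/
theorem soloInformed_nonint_frontier {N D : MvPolynomial (Fin 2) K} {a a' : ℝ → ℝ}
    {u v c d s₀ : ℝ} {Ω : Set (Fin 2 → ℝ)} {f : (Fin 2 → ℝ) → ℝ}
    (hs₀ : u < s₀ ∧ s₀ < v) (ha : ∀ s : ℝ, u < s → s < v → HasDerivAt a (a' s) s)
    (hin : ∀ s : ℝ, u < s → s < v → c < a s ∧ a s < d) (hΩ : IsOpen Ω)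
    (hfr : ∀ z ∈ soloInformedBox2 u v c d, z ∈ frontier Ω → z 1 = a (z 0))
    (hp : (![s₀, a s₀] : Fin 2 → ℝ) ∈ frontier Ω)
    (hZ : ∀ s : ℝ, u < s → s < v → (MvPolynomial.aeval ![s, a s] D : ℝ) = 0)
    (hN : (MvPolynomial.aeval ![s₀, a s₀] N : ℝ) ≠ 0)
    (hD : ∀ z ∈ Ω, (MvPolynomial.aeval z D : ℝ) ≠ 0)
    (hf : EqOn f (fun z => (MvPolynomial.aeval z N : ℝ) / MvPolynomial.aeval z D) Ω)
    (hint : IntegrableOn f Ω) : False := by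
  have hac : ContinuousOn a (Ioo u v) :=
    fun s hs => (ha s hs.1 hs.2).continuousAt.continuousWithinAt
  have hcont : ContinuousAt a s₀ := (ha s₀ hs₀.1 hs₀.2).continuousAt
  have hpB : (![s₀, a s₀] : Fin 2 → ℝ) ∈ soloInformedBox2 u v c d := by
    simp only [soloInformedBox2, mem_setOf_eq, Matrix.cons_val_zero, Matrix.cons_val_one]
    exact ⟨hs₀, hin s₀ hs₀.1 hs₀.2⟩
  rcases soloInformed_side_subset_of_mem_frontier hΩ hac hin hfr hpB hp with h | h
  · obtain ⟨u', v', η, hs₀', hη, hu', hv', hsub⟩ :=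
      soloInformed_exists_adjBand_subset hs₀ hcont hin h
    exact soloInformed_nonint_above hs₀' hη
      (fun s h1 h2 => ha s (lt_of_le_of_lt hu' h1) (lt_of_lt_of_le h2 hv'))
      (fun s h1 h2 => hZ s (lt_of_le_of_lt hu' h1) (lt_of_lt_of_le h2 hv')) hN hsub hD hf hint
  · obtain ⟨u', v', η, hs₀', hη, hu', hv', hsub⟩ :=
      soloInformed_exists_adjBandBelow_subset hs₀ hcont hin h
    exact soloInformed_nonint_below hs₀' hη
      (fun s h1 h2 => ha s (lt_of_le_of_lt hu' h1) (lt_of_lt_of_le h2 hv'))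
      (fun s h1 h2 => hZ s (lt_of_le_of_lt hu' h1) (lt_of_lt_of_le h2 hv')) hN hsub hD hf hint

end Summit.KontsevichZagierPeriods.KontsevichZagierPeriods.Theorems

end
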